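import Summits.HubbardSuperconductivity.HubbardSuperconductivity.Theorems.ThermalWedgeTwSeededEnsembleEquivalenceRColdDiffUniqOfParts

/-!
# Crux `TwSeededEnsembleEquivalenceR` (stmt-HubbardSuperconductivity-15581), line `cold-floor-collapse`
# (slug `Sketch`) — S4a from DIFF and the IN-CLASS form of UNIQ (uniqueness only for small exponents)

Support file (`--supports stmt-HubbardSuperconductivity-15581`; sorry-free; no definition). Skeleton v3/v4 took
the uniqueness of the optimal source modulus (UNIQ, `stub_sourcedColdUniq`) for EVERY exponent `a > 0`, i.e. at
arbitrarily cold slices `β = e^{a/U}` — more than the composition uses (the glue `sourcedColdDiffUniq_of_diff_uniq`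
instantiates it at DIFF's `a₀` only) and more than any convergent-expansion technique could give (no control for
`β > e^{a₀/U}`). Skeleton v5 weakens it to the same quantifier shape as DIFF:

* UNIQ′ (`stub_sourcedColdUniq`, re-registered): on every compact window `⊂ (−4,0)` there is `a₁ > 0` such that
  for all `a ∈ (0, a₁]` (seed floor `K′(a)`, `U ≤ U₀(a)`) the maximisers of `h ↦ q(μ,h) − h²/g` on `|h| ≤ 13g+1`
  lie in `{h*, −h*}`;

and this file re-glues: S4a from DIFF + UNIQ′ with the common exponent `a := min a₀ a₁` (DIFF holds for every
`a ≤ a₀`, UNIQ′ for every `a ≤ a₁`), then verbatim the landed argument (gauge evenness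
`partitionFn_dWaveSourceTorus_neg` passes to the limits, so `q(·,−h*) = q(·,h*)` near `μ` and both signs carry
the derivative of `q(·,h*)`). [folklore composition]
-/

set_option linter.dupNamespace false

namespace Summit.HubbardSuperconductivity.HubbardSuperconductivity.Theorems.TwSeededEnsembleEquivalenceR.ColdFloorLine

open Matrix Filter Topology Finset Literature.MathematicalPhysics.QuantumLattice
open Summit.HubbardSuperconductivity.HubbardSuperconductivity.Theorems.TwSourcedCondensation.Negative
open scoped ComplexOrder

noncomputable section

/-- **S4a (`stub_sourcedColdDiffUniq` shape) from DIFF + UNIQ′ (small-exponent uniqueness).** Take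
`a := min a₀ a₁`, `K' := max`, `U₀ := min` of the two data at that `a`; at an interior `μ` let `h*` be the
modulus of UNIQ′ and `d := deriv (q · h*) μ`; a maximiser is `h*` or `−h*`, and `q(·,−h*) = q(·,h*)` on the
window (evenness of the finite-volume pressures passes to the pointwise limits), so both have derivative `d`.
[folklore composition] -/
theorem sourcedColdDiffUniq_of_diff_uniqSmall :
    (∀ (μ₁ μ₂ : ℝ), -4 < μ₁ → μ₁ < μ₂ → μ₂ < 0 → ∃ a₀ : ℝ, 0 < a₀ ∧ ∀ a ∈ Set.Ioc (0 : ℝ) a₀,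
      ∃ K' U₀ : ℝ, 0 < K' ∧ 0 < U₀ ∧ ∀ U ∈ Set.Ioc (0 : ℝ) U₀, ∀ g ∈ Set.Icc (K' * U) (1 / 10),
        ∀ q : ℝ → ℝ → ℝ,
          (∀ μ ∈ Set.Icc μ₁ μ₂, ∀ h ∈ Set.Icc (-(13 * g + 1)) (13 * g + 1), ∀ κ : ℝ, 0 < κ →
            ∃ L₀ : ℕ, ∀ (L : ℕ) [NeZero L], L₀ ≤ L →
              |Real.log (Matrix.partitionFn (Real.exp (a / U)) (dWaveSourceTorus L U μ h)).re /
                  (Real.exp (a / U) * (L : ℝ) ^ 2) - q μ h| ≤ κ) →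
          ∀ μ ∈ Set.Ioo μ₁ μ₂, ∀ h ∈ Set.Icc (-(13 * g + 1)) (13 * g + 1),
            DifferentiableAt ℝ (fun μ' => q μ' h) μ) →
    (∀ (μ₁ μ₂ : ℝ), -4 < μ₁ → μ₁ < μ₂ → μ₂ < 0 → ∃ a₁ : ℝ, 0 < a₁ ∧ ∀ a ∈ Set.Ioc (0 : ℝ) a₁,
      ∃ K' U₀ : ℝ, 0 < K' ∧ 0 < U₀ ∧ ∀ U ∈ Set.Ioc (0 : ℝ) U₀, ∀ g ∈ Set.Icc (K' * U) (1 / 10),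
        ∀ q : ℝ → ℝ → ℝ,
          (∀ μ ∈ Set.Icc μ₁ μ₂, ∀ h ∈ Set.Icc (-(13 * g + 1)) (13 * g + 1), ∀ κ : ℝ, 0 < κ →
            ∃ L₀ : ℕ, ∀ (L : ℕ) [NeZero L], L₀ ≤ L →
              |Real.log (Matrix.partitionFn (Real.exp (a / U)) (dWaveSourceTorus L U μ h)).re /
                  (Real.exp (a / U) * (L : ℝ) ^ 2) - q μ h| ≤ κ) →
          ∀ μ ∈ Set.Ioo μ₁ μ₂, ∃ hstar : ℝ, ∀ h ∈ Set.Icc (-(13 * g + 1)) (13 * g + 1),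
            q μ h - h ^ 2 / g =
                sSup ((fun h' : ℝ => q μ h' - h' ^ 2 / g) '' Set.Icc (-(13 * g + 1)) (13 * g + 1)) →
              h = hstar ∨ h = -hstar) →
    ∀ (μ₁ μ₂ : ℝ), -4 < μ₁ → μ₁ < μ₂ → μ₂ < 0 → ∃ a K' U₀ : ℝ, 0 < a ∧ 0 < K' ∧ 0 < U₀ ∧
      ∀ U ∈ Set.Ioc (0 : ℝ) U₀, ∀ g ∈ Set.Icc (K' * U) (1 / 10), ∀ q : ℝ → ℝ → ℝ,
        (∀ μ ∈ Set.Icc μ₁ μ₂, ∀ h ∈ Set.Icc (-(13 * g + 1)) (13 * g + 1), ∀ κ : ℝ, 0 < κ →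
            ∃ L₀ : ℕ, ∀ (L : ℕ) [NeZero L], L₀ ≤ L →
              |Real.log (Matrix.partitionFn (Real.exp (a / U)) (dWaveSourceTorus L U μ h)).re /
                  (Real.exp (a / U) * (L : ℝ) ^ 2) - q μ h| ≤ κ) →
        ∀ μ ∈ Set.Ioo μ₁ μ₂, ∃ d : ℝ, ∀ h ∈ Set.Icc (-(13 * g + 1)) (13 * g + 1),
          q μ h - h ^ 2 / g =
              sSup ((fun h' : ℝ => q μ h' - h' ^ 2 / g) '' Set.Icc (-(13 * g + 1)) (13 * g + 1)) →
            HasDerivAt (fun μ' => q μ' h) d μ := by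
  intro hD hUq μ₁ μ₂ h1 h12 h2
  obtain ⟨a₀, ha₀, hDa⟩ := hD μ₁ μ₂ h1 h12 h2
  obtain ⟨a₁, ha₁, hUa⟩ := hUq μ₁ μ₂ h1 h12 h2
  set a : ℝ := min a₀ a₁ with hadef
  have ha : 0 < a := lt_min ha₀ ha₁
  obtain ⟨KD, UD, hKD, hUD, hDmain⟩ := hDa a ⟨ha, min_le_left _ _⟩
  obtain ⟨KU, UU, hKU, hUU, hUmain⟩ := hUa a ⟨ha, min_le_right _ _⟩
  refine ⟨a, max KD KU, min UD UU, ha, lt_max_of_lt_left hKD, lt_min hUD hUU, ?_⟩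
  intro U hU g hg q hq μ hμ
  have hUD' : U ∈ Set.Ioc (0 : ℝ) UD := ⟨hU.1, hU.2.trans (min_le_left _ _)⟩
  have hUU' : U ∈ Set.Ioc (0 : ℝ) UU := ⟨hU.1, hU.2.trans (min_le_right _ _)⟩
  have hgD : g ∈ Set.Icc (KD * U) (1 / 10) :=
    ⟨le_trans (mul_le_mul_of_nonneg_right (le_max_left _ _) hU.1.le) hg.1, hg.2⟩
  have hgU : g ∈ Set.Icc (KU * U) (1 / 10) :=
    ⟨le_trans (mul_le_mul_of_nonneg_right (le_max_right _ _) hU.1.le) hg.1, hg.2⟩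
  set β : ℝ := Real.exp (a / U) with hβdef
  have hβ : 0 < β := Real.exp_pos _
  obtain ⟨hstar, hst⟩ := hUmain U hUU' g hgU q hq μ hμ
  -- evenness of `q` in `h` on the window (limits of even finite-volume pressures)
  have heven : ∀ μ' ∈ Set.Icc μ₁ μ₂, ∀ h ∈ Set.Icc (-(13 * g + 1)) (13 * g + 1), q μ' (-h) = q μ' h := by
    intro μ' hμ' h hh
    have hnh : -h ∈ Set.Icc (-(13 * g + 1)) (13 * g + 1) := ⟨by linarith [hh.2], by linarith [hh.1]⟩
    have hseq : ∀ h₁ ∈ Set.Icc (-(13 * g + 1)) (13 * g + 1), ∀ κ : ℝ, 0 < κ → ∃ N : ℕ, ∀ n, N ≤ n →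
        |Real.log (partitionFn β (dWaveSourceTorus (n + 1) U μ' h₁)).re / (β * (((n + 1 : ℕ) : ℝ)) ^ 2) -
          q μ' h₁| ≤ κ := by
      intro h₁ hh₁ κ hκ
      obtain ⟨L₀, hL₀⟩ := hq μ' hμ' h₁ hh₁ κ hκ
      exact ⟨L₀, fun n hn => hL₀ (n + 1) (by omega)⟩
    have h0 : |q μ' (-h) - q μ' h| ≤ 0 := by
      refine cfb_abs_sub_le_of_limits (hseq (-h) hnh) (hseq h hh) fun n => ?_
      rw [partitionFn_dWaveSourceTorus_neg, sub_self, abs_zero]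
    have := abs_nonneg (q μ' (-h) - q μ' h)
    have h00 : |q μ' (-h) - q μ' h| = 0 := le_antisymm h0 this
    rw [abs_eq_zero, sub_eq_zero] at h00
    exact h00
  refine ⟨deriv (fun μ' => q μ' hstar) μ, fun h hh hmax => ?_⟩
  rcases hst h hh hmax with rfl | rfl
  · exact (hDmain U hUD' g hgD q hq μ hμ h hh).hasDerivAt
  · -- `h = -hstar`: use evenness near `μ`
    have hh' : hstar ∈ Set.Icc (-(13 * g + 1)) (13 * g + 1) := ⟨by linarith [hh.2], by linarith [hh.1]⟩
    have hder : HasDerivAt (fun μ' => q μ' hstar) (deriv (fun μ' => q μ' hstar) μ) μ :=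
      (hDmain U hUD' g hgD q hq μ hμ hstar hh').hasDerivAt
    refine hder.congr_of_eventuallyEq ?_
    filter_upwards [Icc_mem_nhds hμ.1 hμ.2] with μ' hμ'
    exact heven μ' hμ' hstar hh'

end

end Summit.HubbardSuperconductivity.HubbardSuperconductivity.Theorems.TwSeededEnsembleEquivalenceR.ColdFloorLine
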